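import Summits.QuantumFields.GaugeBoot.BootstrapUnitaryGroupCuts
import Literature.MathematicalPhysics.QuantumFieldTheory.ConstructiveQFTWave0OddRPProofs
import HarnessLib

/-!
# Reflection cuts on ODD tori: the Osterwalder–Seiler cuts of the odd half are sound for `β ≥ 0`
# (gauge-boot, L3 ↔ L1)

HONEST FRAMING (cell `pub-gaugeboot`, page 1 of every file): the venture produces certified bounds
on lattice expectations at stated coupling, gauge group, dimension and torus size; NOT a mass gap,
NOT a continuum limit, NOT a string tension; NOT Yang–Mills-summit-bearing (barriers
`FixedCouplingUltralocality`, `PerturbativeInvisibility`). Structural; it certifies no number.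

## Content

The even torus `(ℤ/2Q)^d` carries the site and link frames of the cell's L3 lane
(`BootstrapLinkCutsAllAxes`, `BootstrapSiteCutsAllAxes`). An ODD torus `(ℤ/L)^d` carries no frame
(`not_isSiteFrame_cubicTorus_odd`), but the tree proves Osterwalder–Seiler positivity for the
reflection `θ t = 1 - t` with the ODD closed half (`WilsonOddRP.oPosEdges ∪ oSharedEdges`: temporal
links based at `1 ≤ t ≤ L/2`, spatial links at `1 ≤ t ≤ L/2 + 1`) at `β ≥ 0`
(`wilsonExpectation_oddReflectionPositive`, `L` odd, `L ≥ 3`). With `BootstrapReflectionCutConsistency`: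

* `reflectionPositiveOn_timeReflect_odd` — the packaged statement; `oddCutLevelValuesSuN` /
  `oddCutLevelValuesUN` — the word SDP with the odd-half cuts `0 ≤ φ ((v ∘ Θ) · v)`;
* ★★ `oddCut_of_bootstrap_suN` / `_uN` — `L` odd `≥ 3`, `β ≥ 0`: every solution of the untruncated
  `SU(N)` / `U(N)` torus bootstrap satisfies every odd-half cut; ★★ `wilson_mem_oddCutLevelValues_suN` /
  `_uN`, `oddCutLevelValues_subset_Icc_suN`, ★★★ `oddCuts_sound_and_convergent_suN` — the odd-half cut
  SDP is a sound convergent relaxation.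

What this is NOT: `β < 0` on odd tori (no statement either way here); other axes (the tree's odd
theorem is along the time axis; axis permutations would transport it — not typed); rates.

References: K. Osterwalder, E. Seiler, Ann. Phys. 110 (1978) 440 §2; V. Kazakov, Z. Zheng,
arXiv:2203.11360 §3.1. Folklore-level.
-/

noncomputable section

open MeasureTheory Filter Topology NormedSpace
open scoped ComplexOrder ComplexConjugate
open Literature.MathematicalPhysics.QuantumFieldTheory (LatticeRep Site Edge GaugeConfig wilsonAction wilsonMeasure
  wilsonExpectation isProbabilityMeasure_wilsonMeasure wilsonExpectation_oddReflectionPositive)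
open Literature.MathematicalPhysics.QuantumFieldTheory.WilsonOddRP (oPosEdges oSharedEdges)

namespace Summit.QuantumFields.GaugeBoot

/-! ## The packaged odd-torus statement -/

section Wilson

variable {d L N : ℕ} [NeZero d] [NeZero L] {G : Type*} [Group G] [TopologicalSpace G] [IsTopologicalGroup G]
  [CompactSpace G] [MeasurableSpace G] [BorelSpace G] [SecondCountableTopology G]
  (ρ : G →* Matrix (Fin N) (Fin N) ℂ)

omit [SecondCountableTopology G] in
/-- **Osterwalder–Seiler positivity on the odd torus, packaged** (`L` odd, `L ≥ 3`, continuous `ρ`,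
`β ≥ 0`; tree `wilsonExpectation_oddReflectionPositive`): the Wilson measure is RP for the time
reflection `Θ` on the odd closed half `oPosEdges ∪ oSharedEdges`. -/
theorem reflectionPositiveOn_timeReflect_odd (hL : Odd L) (hL3 : 3 ≤ L) (hρ : Continuous ρ) {β : ℝ}
    (hβ : 0 ≤ β) :
    ReflectionPositiveOn (wilsonMeasure (d := d) (L := L) ρ β) GaugeConfig.timeReflect
      ((oPosEdges ∪ oSharedEdges : Finset (Edge d L)) : Set (Edge d L)) :=
  fun F hF hFb hFS => wilsonExpectation_oddReflectionPositive ρ hL hL3 hρ hβ F hF hFb hFS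

end Wilson

/-! ## The odd-half cut family of the `SU(N)` and `U(N)` bootstrap -/

section Unitary

open Literature.MathematicalPhysics.QuantumLattice

variable {d L : ℕ} [NeZero d] [NeZero L] (N : ℕ) (β : ℝ)

/-- **The level-`n` feasible values of `P` with the odd-half reflection cuts** (`SU(N)`): the instance
`Θ = timeReflectCM`, `S = oPosEdges ∪ oSharedEdges` of `rpCutLevelValuesSuN`. [folklore] -/
def oddCutLevelValuesSuN (n : ℕ) (P : C(GaugeConfig d L (Matrix.specialUnitaryGroup (Fin N) ℂ), ℝ)) : Set ℝ :=
  rpCutLevelValuesSuN N β timeReflectCM ((oPosEdges ∪ oSharedEdges : Finset (Edge d L)) : Set (Edge d L)) n P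

/-- **The level-`n` feasible values of `P` with the odd-half reflection cuts** (`U(N)`). [folklore] -/
def oddCutLevelValuesUN (n : ℕ) (P : C(GaugeConfig d L (Matrix.unitaryGroup (Fin N) ℂ), ℝ)) : Set ℝ :=
  rpCutLevelValuesUN N β timeReflectCM ((oPosEdges ∪ oSharedEdges : Finset (Edge d L)) : Set (Edge d L)) n P

/-- ★★ **`SU(N)`, `L` odd `≥ 3`, `β ≥ 0`: every solution of the untruncated torus bootstrap satisfies
every odd-half reflection cut** `0 ≤ φ ((f ∘ Θ) · f)`. [folklore] -/
theorem oddCut_of_bootstrap_suN (hL : Odd L) (hL3 : 3 ≤ L) (hβ : 0 ≤ β)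
    {φ : C(GaugeConfig d L (Matrix.specialUnitaryGroup (Fin N) ℂ), ℝ) →ₗ[ℝ] ℝ} (h1 : φ 1 = 1)
    (hpos : ∀ a ∈ polyAlgebra (ι := Edge d L) (fundamentalLatticeRep N), 0 ≤ φ (a * a))
    (hφ : IsSDFunctional (fundamentalLatticeRep N) (suExp N) (fun _ => wilsonAction (fundamentalRep (Fin N))) β φ)
    {f : C(GaugeConfig d L (Matrix.specialUnitaryGroup (Fin N) ℂ), ℝ)}
    (hf : f ∈ polyAlgebra (ι := Edge d L) (fundamentalLatticeRep N))
    (hfS : DependsOn (⇑f) ((oPosEdges ∪ oSharedEdges : Finset (Edge d L)) : Set (Edge d L))) :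
    0 ≤ φ (f.comp timeReflectCM * f) :=
  rpCut_of_bootstrap_suN
    (reflectionPositiveOn_timeReflect_odd (fundamentalRep (Fin N)) hL hL3 (continuous_fundamentalRep _) hβ)
    (fun _ hg => comp_timeReflectCM_mem_polyAlgebra _ hg) h1 hpos hφ hf hfS

/-- ★★ **`U(N)`, `L` odd `≥ 3`, `β ≥ 0`: every solution satisfies every odd-half reflection cut.**
[folklore] -/
theorem oddCut_of_bootstrap_uN (hL : Odd L) (hL3 : 3 ≤ L) (hβ : 0 ≤ β)
    {φ : C(GaugeConfig d L (Matrix.unitaryGroup (Fin N) ℂ), ℝ) →ₗ[ℝ] ℝ} (h1 : φ 1 = 1)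
    (hpos : ∀ a ∈ polyAlgebra (ι := Edge d L) (unitaryFundamentalLatticeRep N), 0 ≤ φ (a * a))
    (hφ : IsSDFunctional (unitaryFundamentalLatticeRep N) (uExp N)
      (fun _ => wilsonAction (unitaryFundamentalRep (Fin N) ℂ)) β φ)
    {f : C(GaugeConfig d L (Matrix.unitaryGroup (Fin N) ℂ), ℝ)}
    (hf : f ∈ polyAlgebra (ι := Edge d L) (unitaryFundamentalLatticeRep N))
    (hfS : DependsOn (⇑f) ((oPosEdges ∪ oSharedEdges : Finset (Edge d L)) : Set (Edge d L))) :
    0 ≤ φ (f.comp timeReflectCM * f) :=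
  rpCut_of_bootstrap_uN
    (reflectionPositiveOn_timeReflect_odd (unitaryFundamentalRep (Fin N) ℂ) hL hL3
      (continuous_unitaryFundamentalRep (n := Fin N) (𝕜 := ℂ)) hβ)
    (fun _ hg => comp_timeReflectCM_mem_polyAlgebra _ hg) h1 hpos hφ hf hfS

/-- ★★ **The Wilson value satisfies the odd-half cuts at every level** (`SU(N)`, `L` odd `≥ 3`,
`β ≥ 0`). [folklore] -/
theorem wilson_mem_oddCutLevelValues_suN (hL : Odd L) (hL3 : 3 ≤ L) (hβ : 0 ≤ β) (n : ℕ)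
    (P : C(GaugeConfig d L (Matrix.specialUnitaryGroup (Fin N) ℂ), ℝ)) :
    ∫ U, P U ∂(wilsonMeasure (fundamentalRep (Fin N)) β) ∈ oddCutLevelValuesSuN (d := d) (L := L) N β n P :=
  wilson_mem_rpCutLevelValues_suN
    (reflectionPositiveOn_timeReflect_odd (fundamentalRep (Fin N)) hL hL3 (continuous_fundamentalRep _) hβ) n P

/-- ★★ **The Wilson value satisfies the odd-half cuts at every level** (`U(N)`). [folklore] -/
theorem wilson_mem_oddCutLevelValues_uN (hL : Odd L) (hL3 : 3 ≤ L) (hβ : 0 ≤ β) (n : ℕ)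
    (P : C(GaugeConfig d L (Matrix.unitaryGroup (Fin N) ℂ), ℝ)) :
    ∫ U, P U ∂(wilsonMeasure (unitaryFundamentalRep (Fin N) ℂ) β) ∈ oddCutLevelValuesUN (d := d) (L := L) N β n P :=
  wilson_mem_rpCutLevelValues_uN
    (reflectionPositiveOn_timeReflect_odd (unitaryFundamentalRep (Fin N) ℂ) hL hL3
      (continuous_unitaryFundamentalRep (n := Fin N) (𝕜 := ℂ)) hβ) n P

/-- ★★ **The odd-half cut SDP bounds converge to the Wilson value** (every real `β`). [folklore] -/
theorem oddCutLevelValues_subset_Icc_suN {P : C(GaugeConfig d L (Matrix.specialUnitaryGroup (Fin N) ℂ), ℝ)}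
    (hP : P ∈ polyAlgebra (ι := Edge d L) (fundamentalLatticeRep N)) {ε : ℝ} (hε : 0 < ε) :
    ∀ᶠ n in atTop, oddCutLevelValuesSuN (d := d) (L := L) N β n P ⊆
      Set.Icc (∫ U, P U ∂(wilsonMeasure (fundamentalRep (Fin N)) β) - ε)
        (∫ U, P U ∂(wilsonMeasure (fundamentalRep (Fin N)) β) + ε) :=
  rpCutLevelValues_subset_Icc_suN hP hε

/-- ★★★ **Summary, odd tori**: `(ℤ/L)^d`, `L` odd `≥ 3`, `β ≥ 0`, every `N`, every polynomial
observable `P`, every `ε > 0`: the `SU(N)` word SDP with the odd-half reflection cuts has at every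
level a NONEMPTY feasible set containing the Wilson value, and these sets shrink into `[W - ε, W + ε]`.
[folklore] -/
theorem oddCuts_sound_and_convergent_suN (hL : Odd L) (hL3 : 3 ≤ L) (hβ : 0 ≤ β)
    {P : C(GaugeConfig d L (Matrix.specialUnitaryGroup (Fin N) ℂ), ℝ)}
    (hP : P ∈ polyAlgebra (ι := Edge d L) (fundamentalLatticeRep N)) {ε : ℝ} (hε : 0 < ε) :
    (∀ n, ∫ U, P U ∂(wilsonMeasure (fundamentalRep (Fin N)) β) ∈ oddCutLevelValuesSuN (d := d) (L := L) N β n P) ∧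
      ∀ᶠ n in atTop, oddCutLevelValuesSuN (d := d) (L := L) N β n P ⊆
        Set.Icc (∫ U, P U ∂(wilsonMeasure (fundamentalRep (Fin N)) β) - ε)
          (∫ U, P U ∂(wilsonMeasure (fundamentalRep (Fin N)) β) + ε) :=
  ⟨fun n => wilson_mem_oddCutLevelValues_suN N β hL hL3 hβ n P, oddCutLevelValues_subset_Icc_suN N β hP hε⟩

end Unitary

end Summit.QuantumFields.GaugeBoot

end
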